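import Literature.Computability.AlgebraicComplexity.LowDepthRankBound
import HarnessLib

/-!
# Route `DepthWindow` — the flat-threshold two-case rank induction for circuits with homogeneous gate values

Helper file of the route `Theses/DepthWindow.lean` (decomp-valiant workshop, lens 4, generation 9; port plan `PLAN-w2`
§2/F3: the engine half of the kernel column «Hard(σ), σ < 1» of the slope–rate dial, i.e. of `HomImmHardAt p q`, `p < q`).
Setting and API of `Literature/Computability/AlgebraicComplexity/LowDepthRankBound.lean`: a word (`pos`, `k`) with blocks
`LSTWord.BlockVar k pos i`, a circuit `P` over a finite `σ₀`, a block-preserving substitution `g`, the values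
`LSTWord.InL k pos g P p x` of level `p`, the measure `relRank K pos T`.  NEW HYPOTHESIS (rigidity of constant terms =
the semantic shadow of homogeneity; `rigid_of_gateValues` derives it from «all gate values of `P` homogeneous», the
literal hypothesis of `HomImmHardAt`): every value in play with a nonzero constant term is a constant.  Under it the
product-gate step needs no Newton identities and no de-duplication: the constant-full operands multiply to a constant,
more than `#T` constant-free operands kill `smlProj T` (`smlProj_list_prod_eq_zero_of_card_lt`), otherwise `smlProj T`
of the product is a combination of `≤ #T^{#T} ≤ d^d` generators `partProd`, each settled by the two-case dichotomy
`LSTWord.relRank_prod_partition_le`.  The induction hypothesis is FLAT in `#T` (shape of [BhargavDuttaSaxena2024,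
Lemma 7]: `relrk_T ≤ Λ_p ε` for all `#T ≥ θ_p`) with an arbitrary threshold sequence `θ`; side conditions `1 < θ_p`,
`10 θ_p² ≤ k`, `2^{-k θ_{p+1}/(20 θ_p²)} ≤ ε` (`p < Δ`) and `θ_Δ ≤ d`.  Output `relRank_eval_le_flat`:
`relrk_{[d]}(g(P)) ≤ (s d^d + 1)^Δ ε`; geometric instance `relRank_eval_le_geom` (`θ_p = λ^{2^p-1} 2^{2^p}`): bound
`(s d^d + 1)^Δ 2^{-kλ/20}` whenever `λ^{2^Δ-1} 2^{2^Δ} ≤ d`, `10 d ≤ k` — with `λ = (d/2^{2^Δ})^{1/(2^Δ-1)} ≥ d^{1/(2^Δ-1)}/4`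
this is exactly the LST 2021 set-multilinear exponent `d^{1/(2^Δ-1)}` (the tree's general-circuit engine `lst_explicit`
has `d^{μ_Δ}`, `μ_Δ ≈ 2^{-(2Δ+1)}`).  The IMM assembly and the asymptotics are the remaining files of `PLAN-w2` R1.
Unconditional, 0 sorry, def-free; rung currency only — nothing here bears on `VP ≠ VNP` itself.
References: [LimayeSrinivasanTavenas2025] §5, Lemma 12, Claim 16, Claim 17; [BhargavDuttaSaxena2024] Lemma 7, §1.3.
-/


-- layout Summits/ValiantsHypothesis/ValiantsHypothesis forces the duplicated namespace component
set_option linter.dupNamespace false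

namespace Summit.ValiantsHypothesis.ValiantsHypothesis.Theorems.DepthWindow

open MvPolynomial Finsupp Literature.Computability.AlgebraicComplexity
open Literature.Computability.AlgebraicComplexity.LSTWord

noncomputable section

universe u

variable {K : Type u} [Field K]

/-- A list of constants multiplies to a constant. [folklore] -/
theorem exists_list_prod_eq_C {σ : Type*} (M : List (MvPolynomial σ K))
    (h : ∀ u ∈ M, ∃ c : K, u = C c) : ∃ c : K, M.prod = C c := by
  induction M with
  | nil => exact ⟨1, by simp⟩
  | cons a M ih =>
    obtain ⟨ca, hca⟩ := h a (by simp)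
    obtain ⟨cm, hcm⟩ := ih fun u hu => h u (by simp [hu])
    exact ⟨ca * cm, by rw [List.prod_cons, hca, hcm, C_mul]⟩

/-- A homogeneous polynomial with a nonzero constant term is a constant. [folklore] -/
theorem eq_C_of_isHomogeneous_of_coeff_zero_ne {σ : Type*} {x : MvPolynomial σ K} {e : ℕ}
    (hx : x.IsHomogeneous e) (h0 : coeff 0 x ≠ 0) : x = C (coeff 0 x) := by
  have he : e = 0 := by
    have h := hx h0
    simpa using h.symm
  subst he
  exact totalDegree_eq_zero_iff_eq_C.1 ((totalDegree_zero_iff_isHomogeneous _).2 hx)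

variable {d : ℕ} {k : ℕ} {pos : Fin d → Bool}
variable {σ₀ : Type} [Fintype σ₀] {blk₀ : σ₀ → Fin d}
variable {g : σ₀ → MvPolynomial (Σ i : Fin d, BlockVar k pos i) K} {P : ArithCircuit K σ₀}

omit [Fintype σ₀] in
/-- The gate values of a circuit all of whose gate values are homogeneous stay homogeneous along a substitution by
homogeneous forms of degree `1`; junk indices give `0`. [folklore] -/
theorem isHomogeneous_aeval_gateVal (hP : ∀ v ∈ ArithCircuit.gateValues P.gates, ∃ e : ℕ, v.IsHomogeneous e)
    (hg1 : ∀ v, (g v).IsHomogeneous 1) (j : ℕ) : ∃ e : ℕ, (aeval g (P.gateVal j)).IsHomogeneous e := by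
  unfold ArithCircuit.gateVal
  rw [List.getD_eq_getElem?_getD]
  cases hj : (ArithCircuit.gateValues P.gates)[j]? with
  | none => exact ⟨0, by simp [isHomogeneous_zero]⟩
  | some v =>
    obtain ⟨e, he⟩ := hP v (List.mem_of_getElem? hj)
    exact ⟨1 * e, by simpa only [Option.getD_some] using he.aeval g hg1⟩

omit [Fintype σ₀] in
/-- **Rigidity from homogeneity**: if every gate value of `P` pushed along `g` is homogeneous and every `g v` is
homogeneous, then every value of level `Δ` with a nonzero constant term is a constant. [folklore] -/
theorem rigid_of_isHomogeneous {Δ : ℕ} (hgate : ∀ j, ∃ e : ℕ, (aeval g (P.gateVal j)).IsHomogeneous e)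
    (hvar : ∀ v, ∃ e : ℕ, (g v).IsHomogeneous e) :
    ∀ x, InL k pos g P Δ x → coeff 0 x ≠ 0 → ∃ c : K, x = C c := by
  rintro x (⟨j, -, rfl⟩ | ⟨v, rfl⟩ | ⟨c, rfl⟩) h0
  · obtain ⟨e, he⟩ := hgate j
    exact ⟨_, eq_C_of_isHomogeneous_of_coeff_zero_ne he h0⟩
  · obtain ⟨e, he⟩ := hvar v
    exact ⟨_, eq_C_of_isHomogeneous_of_coeff_zero_ne he h0⟩
  · exact ⟨c, rfl⟩

omit [Fintype σ₀] in
/-- A block-preserving substitution consists of homogeneous forms of degree `1` (block-linear forms).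
[cite: LimayeSrinivasanTavenas2025, Lemma 8] -/
theorem isHomogeneous_one_of_isBlockPreserving (hg : IsBlockPreserving blk₀ Sigma.fst g) (v : σ₀) :
    (g v).IsHomogeneous 1 := by
  intro m hm
  have h := hg v hm
  have e1 : weight (1 : (Σ i : Fin d, BlockVar k pos i) → ℕ) m = degree m := by
    rw [degree_eq_weight_one]; rfl
  rw [e1, ← degree_mapDomain Sigma.fst m, ← weight_blockWeight_eq_mapDomain, h, degree_single]

omit [Fintype σ₀] in
/-- **Rigidity from the hypothesis of `HomImmHardAt`**: if all gate values of `P` are homogeneous and `g` is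
block-preserving, every value of every level with a nonzero constant term is a constant. [folklore] -/
theorem rigid_of_gateValues (hg : IsBlockPreserving blk₀ Sigma.fst g)
    (hP : ∀ v ∈ ArithCircuit.gateValues P.gates, ∃ e : ℕ, v.IsHomogeneous e) (Δ : ℕ) :
    ∀ x, InL k pos g P Δ x → coeff 0 x ≠ 0 → ∃ c : K, x = C c :=
  rigid_of_isHomogeneous (isHomogeneous_aeval_gateVal hP (isHomogeneous_one_of_isBlockPreserving hg))
    fun v => ⟨1, isHomogeneous_one_of_isBlockPreserving hg v⟩

omit [Fintype σ₀] in
/-- A block-linear leaf has `relrk_T = 0` as soon as `#T ≥ 2`. [cite: LimayeSrinivasanTavenas2025, §2.1] -/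
theorem relRank_var_eq_zero_of_two_le (hg : IsBlockPreserving blk₀ Sigma.fst g) (v : σ₀)
    {T : Finset (Fin d)} (hT2 : 2 ≤ T.card) : relRank K pos T (g v) = 0 := by
  refine relRank_eq_zero_of_blockLinear k pos (hg v) fun h => ?_
  rw [h, Finset.card_singleton] at hT2
  omega

/-- **Sum closure at a fixed block set** `T` with `#T ≥ 2`: if every product gate of product-depth `≤ p` has
`relrk_T ≤ B`, then every gate of product-depth `≤ p` has `relrk_T ≤ s · B` (the leaves contribute `0`).
[cite: LimayeSrinivasanTavenas2025, Claim 16] -/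
theorem relRank_gate_le_flat (hg : IsBlockPreserving blk₀ Sigma.fst g) (p : ℕ) {B : ℝ} (hB : 0 ≤ B)
    {T : Finset (Fin d)} (hT2 : 2 ≤ T.card)
    (hprod : ∀ j args, P.gates[j]? = some (.prod args) → P.gatePD j ≤ p →
      relRank K pos T (aeval g (P.gateVal j)) ≤ B)
    (j : ℕ) (hj : P.gatePD j ≤ p) :
    relRank K pos T (aeval g (P.gateVal j)) ≤ P.size * B := by
  classical
  have hT : T.Nonempty := Finset.card_pos.1 (by omega)
  have hmem : aeval g (P.gateVal j) ∈ Submodule.span K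
      (Set.range fun y => aeval g (P.spanFamily p y)) := by
    have h1 := P.span_spanFamily_mono hj (P.gateVal_mem_span_spanFamily j)
    have h2 : aeval g (P.gateVal j) ∈
        Submodule.span K ((aeval g).toLinearMap '' Set.range (P.spanFamily p)) := by
      rw [← Submodule.map_span]
      exact Submodule.mem_map_of_mem h1
    rwa [← Set.range_comp] at h2
  refine (relRank_le_sum_of_mem_span pos T hmem).trans ?_
  rw [Fintype.sum_sum_type, Fintype.sum_sum_type]
  have h1 : ∑ j' : Fin P.size, relRank K pos T (aeval g (P.spanFamily p (.inl j'))) ≤ P.size * B := by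
    calc ∑ j' : Fin P.size, relRank K pos T (aeval g (P.spanFamily p (.inl j')))
        ≤ ∑ _j' : Fin P.size, B := Finset.sum_le_sum fun j' _ => by
          rcases P.spanFamily_inl_eq p j' with h0 | ⟨⟨args, hargs⟩, hpd, heq⟩
          · rw [h0, map_zero, relRank_zero]; exact hB
          · rw [heq]; exact hprod j' args hargs hpd
      _ = P.size * B := by
          rw [Finset.sum_const, Finset.card_univ, Fintype.card_fin, nsmul_eq_mul]
  have h2 : ∑ v : σ₀, relRank K pos T (aeval g (P.spanFamily p (.inr (.inl v)))) = 0 := by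
    refine Finset.sum_eq_zero fun v _ => ?_
    simp only [ArithCircuit.spanFamily, aeval_X]
    exact relRank_var_eq_zero_of_two_le hg v hT2
  have h3 : ∑ u : Unit, relRank K pos T (aeval g (P.spanFamily p (.inr (.inr u)))) = 0 := by
    rw [Fintype.sum_unique]
    simp only [ArithCircuit.spanFamily, map_one]
    rw [← C_1]
    exact relRank_C_eq_zero k pos 1 hT
  rw [h2, h3, add_zero, add_zero]
  exact h1

omit [Fintype σ₀] in
/-- **Product gates** (LST 2025, Claim 16, the two cases, for homogeneous values): if every value of level `p` has
`relrk_{T'} ≤ Λ ε` for `#T' ≥ θ_p`, the constant-full operand values are constants, `10 θ_p² ≤ k` and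
`2^{-k θ_{p+1}/(20 θ_p²)} ≤ ε`, then a product gate of product-depth `≤ p + 1` has `relrk_T ≤ d^d Λ ε` for
`#T ≥ θ_{p+1}`. [cite: LimayeSrinivasanTavenas2025, Claim 16] -/
theorem relRank_prodGate_le_flat {θ : ℕ → ℝ} {ε Λ : ℝ} {p : ℕ} (hΛ : 1 ≤ Λ) (hε : 0 < ε)
    (hIH : ∀ x, InL k pos g P p x → ∀ T : Finset (Fin d), θ p ≤ (T.card : ℝ) →
      relRank K pos T x ≤ Λ * ε)
    (hrig : ∀ x, InL k pos g P p x → coeff 0 x ≠ 0 → ∃ c : K, x = C c)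
    (hθk : 10 * θ p ^ 2 ≤ k)
    (hstep : (2 : ℝ) ^ (-(k : ℝ) * θ (p + 1) / (20 * θ p ^ 2)) ≤ ε)
    {j : ℕ} {args : List (ArithCircuit.Operand K σ₀)}
    (hj : P.gates[j]? = some (.prod args)) (hpd : P.gatePD j ≤ p + 1)
    {T : Finset (Fin d)} (hT : θ (p + 1) ≤ (T.card : ℝ)) (hd : 1 ≤ d) :
    relRank K pos T (aeval g (P.gateVal j)) ≤ (d ^ d : ℕ) * (Λ * ε) := by
  classical
  have hΛε : 0 ≤ Λ * ε := mul_nonneg (by linarith) hε.le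
  -- the operand values
  set L := args.map fun u => aeval g (P.opVal j u) with hLdef
  have hval : aeval g (P.gateVal j) = L.prod := by
    rw [P.gateVal_of_prod hj, map_list_prod, List.map_map]
    rfl
  have hL : ∀ x ∈ L, InL k pos g P p x := by
    intro x hx
    obtain ⟨u, hu, rfl⟩ := List.mem_map.1 hx
    refine (inL_opVal j u).mono ?_
    have := P.opPD_succ_le_gatePD_of_prod hj hu
    omega
  -- the constant-full operands multiply to a constant (rigidity)
  obtain ⟨c₁, hc₁⟩ : ∃ c : K, (unitOps L).prod = C c :=
    exists_list_prod_eq_C _ fun u hu =>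
      hrig u (hL u (mem_of_mem_unitOps hu)) (coeff_zero_ne_of_mem_unitOps hu)
  rw [hval, ← relRank_smlProj pos T, prod_eq_zeroOps_prod_mul_unitOps_prod L, hc₁,
    show (zeroOps L).prod * C c₁ = C c₁ * (zeroOps L).prod from mul_comm _ _, smlProj_C_mul]
  by_cases hz : T.card < (zeroOps L).length
  · -- more than `#T` constant-free operands: the projection vanishes
    rw [smlProj_list_prod_eq_zero_of_card_lt Sigma.fst T (zeroOps L)
      (fun u hu => coeff_zero_of_mem_zeroOps hu) hz, mul_zero, relRank_zero]
    exact mul_nonneg (Nat.cast_nonneg _) hΛε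
  · push Not at hz
    obtain ⟨cf, hcf⟩ := exists_smlProj_list_prod_eq_sum Sigma.fst T (zeroOps L)
    have hmem : C c₁ * smlProj Sigma.fst T (zeroOps L).prod ∈
        Submodule.span K (Set.range (partProd Sigma.fst T (zeroOps L))) := by
      rw [MvPolynomial.C_mul', hcf]
      refine Submodule.smul_mem _ _ (Submodule.sum_mem _ fun a _ => ?_)
      exact Submodule.smul_mem _ _ (Submodule.subset_span ⟨a, rfl⟩)
    refine (relRank_le_sum_of_mem_span pos T hmem).trans ?_
    -- each generator: the two cases
    have hgen : ∀ a : (T → Fin (zeroOps L).length),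
        relRank K pos T (partProd Sigma.fst T (zeroOps L) a) ≤ Λ * ε := by
      intro a
      have h := relRank_prod_partition_le (K := K) (k := k) (pos := pos)
        (blockPart T a) (fun q => smlProj Sigma.fst (blockPart T a q) (zeroOps L)[q])
        (fun q _ q' _ hne => disjoint_blockPart a hne)
        (fun q => isSetMultilinear_smlProj Sigma.fst _ _) (C := Λ * ε) hθk
        (fun q hq => by
          rw [relRank_smlProj pos (blockPart T a q)]
          exact hIH _ (hL _ (mem_of_mem_zeroOps (List.getElem_mem _))) _ hq)
      rw [biUnion_blockPart] at h
      refine h.trans (max_le le_rfl ?_)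
      have hsum : (∑ x, ((blockPart T a x).card : ℝ)) = T.card := by
        rw [← Nat.cast_sum, sum_card_blockPart]
      rw [hsum]
      refine le_trans ?_ (hstep.trans (le_mul_of_one_le_left hε.le hΛ))
      refine Real.rpow_le_rpow_of_exponent_le (by norm_num) ?_
      have hk0 : (0 : ℝ) ≤ k := Nat.cast_nonneg k
      rcases (show (0 : ℝ) ≤ 20 * θ p ^ 2 by positivity).eq_or_lt with hθ0 | hθpos
      · rw [← hθ0, div_zero, div_zero]
      · rw [div_le_div_iff_of_pos_right hθpos]
        nlinarith [mul_le_mul_of_nonneg_left hT hk0]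
    calc ∑ a, relRank K pos T (partProd Sigma.fst T (zeroOps L) a)
        ≤ ∑ _a : (T → Fin (zeroOps L).length), Λ * ε := Finset.sum_le_sum fun a _ => hgen a
      _ = (Fintype.card (T → Fin (zeroOps L).length) : ℝ) * (Λ * ε) := by
          rw [Finset.sum_const, Finset.card_univ, nsmul_eq_mul]
      _ ≤ (d ^ d : ℕ) * (Λ * ε) := by
          refine mul_le_mul_of_nonneg_right ?_ hΛε
          have hTd : T.card ≤ d := by simpa using Finset.card_le_univ T
          have hcard : Fintype.card (T → Fin (zeroOps L).length) ≤ d ^ d := by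
            rw [Fintype.card_fun, Fintype.card_fin, Fintype.card_coe]
            calc (zeroOps L).length ^ T.card ≤ d ^ T.card := Nat.pow_le_pow_left (hz.trans hTd) _
              _ ≤ d ^ d := Nat.pow_le_pow_right hd hTd
          exact_mod_cast hcard

/-- **One level up** (LST 2025, Claim 16, induction step; flat form): from the bound `Λ ε` at level `p` above
`θ_p` to the bound `(s d^d + 1) Λ ε` at level `p + 1` above `θ_{p+1}`. [cite: LimayeSrinivasanTavenas2025, Claim 16] -/
theorem relRank_le_flat_succ (hg : IsBlockPreserving blk₀ Sigma.fst g) {θ : ℕ → ℝ} {ε Λ : ℝ} {p : ℕ}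
    (hΛ : 1 ≤ Λ) (hε : 0 < ε)
    (hIH : ∀ x, InL k pos g P p x → ∀ T : Finset (Fin d), θ p ≤ (T.card : ℝ) →
      relRank K pos T x ≤ Λ * ε)
    (hrig : ∀ x, InL k pos g P p x → coeff 0 x ≠ 0 → ∃ c : K, x = C c)
    (hθk : 10 * θ p ^ 2 ≤ k)
    (hstep : (2 : ℝ) ^ (-(k : ℝ) * θ (p + 1) / (20 * θ p ^ 2)) ≤ ε)
    (hθ1 : 1 < θ (p + 1)) (hd : 1 ≤ d) :
    ∀ x, InL k pos g P (p + 1) x → ∀ T : Finset (Fin d), θ (p + 1) ≤ (T.card : ℝ) →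
      relRank K pos T x ≤ ((P.size * d ^ d + 1 : ℕ) : ℝ) * Λ * ε := by
  intro x hx T hT
  have hT2 : 2 ≤ T.card := by
    have h1 : (1 : ℝ) < T.card := hθ1.trans_le hT
    have h2 : 1 < T.card := by exact_mod_cast h1
    omega
  have hT0 : T.Nonempty := Finset.card_pos.1 (by omega)
  have hΛε : 0 ≤ Λ * ε := mul_nonneg (by linarith) hε.le
  have hbound : 0 ≤ ((P.size * d ^ d + 1 : ℕ) : ℝ) * Λ * ε := by
    rw [mul_assoc]; exact mul_nonneg (Nat.cast_nonneg _) hΛε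
  rcases hx with ⟨j, hj, rfl⟩ | ⟨v, rfl⟩ | ⟨c, rfl⟩
  · have hB : (0 : ℝ) ≤ (d ^ d : ℕ) * (Λ * ε) := mul_nonneg (Nat.cast_nonneg _) hΛε
    have h := relRank_gate_le_flat hg (p + 1) hB hT2
      (fun j' args hargs hpd => relRank_prodGate_le_flat hΛ hε hIH hrig hθk hstep hargs hpd hT hd) j hj
    refine h.trans ?_
    have hs : (0 : ℝ) ≤ P.size := Nat.cast_nonneg _
    calc (P.size : ℝ) * ((d ^ d : ℕ) * (Λ * ε))
        = ((P.size * d ^ d : ℕ) : ℝ) * (Λ * ε) := by push_cast; ring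
      _ ≤ ((P.size * d ^ d + 1 : ℕ) : ℝ) * (Λ * ε) := by
          refine mul_le_mul_of_nonneg_right ?_ hΛε
          exact_mod_cast Nat.le_succ _
      _ = _ := by ring
  · rw [relRank_var_eq_zero_of_two_le hg v hT2]; exact hbound
  · rw [relRank_C_eq_zero k pos c hT0]; exact hbound

/-- **All levels** (LST 2025, Claim 16 by induction on the product-depth; flat thresholds): with `1 < θ_p` for all
`p`, `10 θ_p² ≤ k` and `2^{-k θ_{p+1}/(20 θ_p²)} ≤ ε` for `p < Δ`, and rigid constant terms at level `Δ`, every value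
of level `p ≤ Δ` has `relrk_T ≤ (s d^d + 1)^p ε` for `#T ≥ θ_p`. [cite: LimayeSrinivasanTavenas2025, Claim 16] -/
theorem relRank_le_flat_all (hg : IsBlockPreserving blk₀ Sigma.fst g) {θ : ℕ → ℝ} {ε : ℝ} (hε : 0 < ε)
    (hd : 1 ≤ d) {Δ : ℕ} (hθ1 : ∀ p, 1 < θ p) (hθk : ∀ p, p < Δ → 10 * θ p ^ 2 ≤ k)
    (hstep : ∀ p, p < Δ → (2 : ℝ) ^ (-(k : ℝ) * θ (p + 1) / (20 * θ p ^ 2)) ≤ ε)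
    (hrig : ∀ x, InL k pos g P Δ x → coeff 0 x ≠ 0 → ∃ c : K, x = C c) :
    ∀ p, p ≤ Δ → ∀ x, InL k pos g P p x → ∀ T : Finset (Fin d), θ p ≤ (T.card : ℝ) →
      relRank K pos T x ≤ ((P.size * d ^ d + 1 : ℕ) : ℝ) ^ p * ε := by
  intro p
  induction p with
  | zero =>
    intro _ x hx T hT
    have hT2 : 2 ≤ T.card := by
      have h1 : (1 : ℝ) < T.card := (hθ1 0).trans_le hT
      have h2 : 1 < T.card := by exact_mod_cast h1
      omega
    have hT0 : T.Nonempty := Finset.card_pos.1 (by omega)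
    rw [pow_zero, one_mul]
    rcases hx with ⟨j, hj, rfl⟩ | ⟨v, rfl⟩ | ⟨c, rfl⟩
    · have h := relRank_gate_le_flat hg 0 (B := 0) le_rfl hT2
        (fun j' args hargs hpd => absurd (one_le_gatePD_of_prod hargs) (by omega)) j hj
      rw [mul_zero] at h
      exact h.trans hε.le
    · rw [relRank_var_eq_zero_of_two_le hg v hT2]; exact hε.le
    · rw [relRank_C_eq_zero k pos c hT0]; exact hε.le
  | succ p ih =>
    intro hp x hx T hT
    have hp' : p < Δ := by omega
    have hΛ : (1 : ℝ) ≤ ((P.size * d ^ d + 1 : ℕ) : ℝ) ^ p := by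
      refine one_le_pow₀ ?_
      exact_mod_cast Nat.le_add_left 1 _
    have h := relRank_le_flat_succ hg hΛ hε (ih hp'.le)
      (fun y hy hy0 => hrig y (hy.mono hp'.le) hy0) (hθk p hp') (hstep p hp') (hθ1 (p + 1)) hd x hx T hT
    rw [pow_succ]
    linarith [h]

/-- **The output** (flat form of LST 2025, Lemma 15 / Claim 16 for homogeneous circuits): under the hypotheses of
`relRank_le_flat_all` and `θ_Δ ≤ d`, a circuit of product-depth `≤ Δ` satisfies
`relrk_{[d]}(g(P)) ≤ (s d^d + 1)^Δ · ε`. [cite: LimayeSrinivasanTavenas2025, Lemma 15] -/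
theorem relRank_eval_le_flat (hg : IsBlockPreserving blk₀ Sigma.fst g) {θ : ℕ → ℝ} {ε : ℝ} (hε : 0 < ε)
    (hd : 1 ≤ d) {Δ : ℕ} (hθ1 : ∀ p, 1 < θ p) (hθk : ∀ p, p < Δ → 10 * θ p ^ 2 ≤ k)
    (hstep : ∀ p, p < Δ → (2 : ℝ) ^ (-(k : ℝ) * θ (p + 1) / (20 * θ p ^ 2)) ≤ ε)
    (hrig : ∀ x, InL k pos g P Δ x → coeff 0 x ≠ 0 → ∃ c : K, x = C c)
    (hΔ : P.productDepth ≤ Δ) (hfit : θ Δ ≤ d) :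
    relRank K pos Finset.univ (aeval g P.eval) ≤ ((P.size * d ^ d + 1 : ℕ) : ℝ) ^ Δ * ε := by
  have hx : InL k pos g P Δ (aeval g P.eval) := by
    rw [P.eval_eq_opVal_output]
    refine (inL_opVal P.size P.output).mono ?_
    rwa [← P.productDepth_eq_opPD_output]
  refine relRank_le_flat_all hg hε hd hθ1 hθk hstep hrig Δ le_rfl _ hx Finset.univ ?_
  rwa [Finset.card_univ, Fintype.card_fin]

/-- The geometric thresholds exceed `1`. [folklore] -/
theorem one_lt_of_geom {lam : ℝ} (hlam : 1 ≤ lam) {θ : ℕ → ℝ} (hθ0 : θ 0 = 2)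
    (hθs : ∀ p, θ (p + 1) = lam * θ p ^ 2) (p : ℕ) : 1 < θ p := by
  induction p with
  | zero => rw [hθ0]; norm_num
  | succ p ih =>
    rw [hθs]
    have h1 : 1 < θ p ^ 2 := by nlinarith
    nlinarith

/-- The geometric thresholds increase. [folklore] -/
theorem geom_mono {lam : ℝ} (hlam : 1 ≤ lam) {θ : ℕ → ℝ} (hθ0 : θ 0 = 2)
    (hθs : ∀ p, θ (p + 1) = lam * θ p ^ 2) {p q : ℕ} (hpq : p ≤ q) : θ p ≤ θ q := by
  induction hpq with
  | refl => exact le_rfl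
  | step _ ih =>
    refine ih.trans ?_
    rw [hθs]
    have h1 := one_lt_of_geom hlam hθ0 hθs ‹_›
    nlinarith

/-- **The geometric instance** (LST 2025, Claim 16 with the paper's thresholds, flat form): for `λ ≥ 1` with
`λ^{2^Δ - 1} 2^{2^Δ} ≤ d` and `10 d ≤ k`, a circuit of product-depth `≤ Δ` with rigid constant terms satisfies
`relrk_{[d]}(g(P)) ≤ (s d^d + 1)^Δ · 2^{-k λ/20}`. [cite: LimayeSrinivasanTavenas2025, Claim 16] -/
theorem relRank_eval_le_geom (hg : IsBlockPreserving blk₀ Sigma.fst g) {lam : ℝ} (hlam : 1 ≤ lam)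
    (hk : 10 * d ≤ k) (hd : 1 ≤ d) {Δ : ℕ} (hΔ : P.productDepth ≤ Δ)
    (hfit : lam ^ (2 ^ Δ - 1) * 2 ^ (2 ^ Δ) ≤ (d : ℝ))
    (hrig : ∀ x, InL k pos g P Δ x → coeff 0 x ≠ 0 → ∃ c : K, x = C c) :
    relRank K pos Finset.univ (aeval g P.eval) ≤
      ((P.size * d ^ d + 1 : ℕ) : ℝ) ^ Δ * (2 : ℝ) ^ (-(k : ℝ) * lam / 20) := by
  set θ : ℕ → ℝ := fun p => lam ^ (2 ^ p - 1) * 2 ^ (2 ^ p) with hθdef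
  have hθ0 : θ 0 = 2 := by simp [hθdef]
  have hθs : ∀ p, θ (p + 1) = lam * θ p ^ 2 := by
    intro p
    simp only [hθdef]
    have h1 : 2 ^ (p + 1) - 1 = 2 * (2 ^ p - 1) + 1 := by
      have := Nat.one_le_two_pow (n := p)
      rw [pow_succ]; omega
    rw [h1, pow_succ 2 p]
    ring
  have hθ1 := one_lt_of_geom hlam hθ0 hθs
  have hfit' : θ Δ ≤ d := hfit
  have hkR : 10 * (d : ℝ) ≤ k := by exact_mod_cast hk
  have hθk : ∀ p, p < Δ → 10 * θ p ^ 2 ≤ k := by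
    intro p hp
    have h1 : θ p ^ 2 ≤ θ (p + 1) := by
      rw [hθs]
      have := (hθ1 p).le
      nlinarith
    have h2 : θ (p + 1) ≤ θ Δ := geom_mono hlam hθ0 hθs (by omega)
    linarith
  have hstep : ∀ p, p < Δ → (2 : ℝ) ^ (-(k : ℝ) * θ (p + 1) / (20 * θ p ^ 2)) ≤
      (2 : ℝ) ^ (-(k : ℝ) * lam / 20) := by
    intro p _
    have hθp : 0 < θ p := lt_trans one_pos (hθ1 p)
    have hne : θ p ^ 2 ≠ 0 := by positivity
    rw [hθs]
    refine le_of_eq ?_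
    congr 1
    field_simp
  exact relRank_eval_le_flat hg (by positivity) hd hθ1 hθk hstep hrig hΔ hfit'

end

end Summit.ValiantsHypothesis.ValiantsHypothesis.Theorems.DepthWindow
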